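import Literature.Computability.Cryptography.IndistinguishabilityPostProcessing
import HarnessLib

/-!
# Post-processing ensembles of variable-length samples (Goldreich 2001, §3.2.3) — e.g. padding commitments to a fixed length

Companion of `IndistinguishabilityPostProcessing.lean`, whose `IsCompIndistinguishable.map_fp` requires the
two ensembles to be supported on strings of ONE length `ℓ(n)` per level: the composed distinguisher
`PostProc.lift D F cl` must know `D`'s coin count on the post-processed input, and in the tree's model
(`Randomized.lean`: the coin budget is a function of the input LENGTH) that count is recovered from the
game-input length `2n + 2 + ℓ(n)`. Ensembles such as the commitment strings of a bit-commitment scheme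
(`commitEnsemble`, `CommitmentsSignatures.lean`) have samples of VARYING (polynomially bounded) length at one
level, so one level occupies a whole window `[2n + 2, 2n + 2 + B(n)]` of input lengths and consecutive
windows overlap.

This file proves the variable-length form **`IsCompIndistinguishable.map_fp_of_length_le`**: if `X ≈ Y` have
samples of length `≤ B(n)` and `F ∈ FP` maps every game input `⟨1ⁿ, s⟩`, `|s| ≤ B(n)`, to a string of length
`ℓ'(n)`, then `F(1ⁿ, X) ≈ F(1ⁿ, Y)`. The proof is the contradiction argument of the companion run on a
SPARSE infinite set of bad levels whose windows are pairwise disjoint (`seqW`: from an infinite set of levels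
pick `n₀ < n₁ < ⋯` with `n_{k+1} > 2n_k + 2 + B(n_k)`), so that along those levels the input length again
determines the level (`nOfW_window`) and the advice budget `clW` is well defined; at all other lengths the
budget is `0` (the composed distinguisher is still a legitimate PPT machine, and only its advantage on the
sparse set is used). Typical use: padding the samples to a fixed length (`10*`/length-header codes), after which
the fixed-length lemmas of the tree apply. All proved; no named facts.

## References

* O. Goldreich, *Foundations of Cryptography I*, CUP 2001, §3.2.3 ("The Hybrid Technique: A Digest", PDF p. 141:
  efficient transformations preserve computational indistinguishability), §2.2.3.2 (sparse sets of lengths).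
* S. Arora, B. Barak, *Computational Complexity*, CUP 2009, Def. 7.1 (the random tape of a PTM).
-/

namespace Literature.Computability.Cryptography

open Filter Asymptotics Polynomial _root_.Computability Complexity Complexity.Brick MetaComplexity PRGTrunc PostProc

namespace PostProcVar

/-! ### A sparse sequence of levels with disjoint windows -/

section Sparse

variable {S : Set ℕ} (hS : S.Infinite) (g : ℕ → ℕ)

/-- **A sparse enumeration of an infinite set of levels**: `seqW 0 ∈ S` and `seqW (k+1) ∈ S` exceeds
`g (seqW k)` (the end of the previous window). [cite: Goldreich2001, §2.2.3.2 (sparse sets of lengths)] -/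
noncomputable def seqW : ℕ → ℕ
  | 0 => Classical.choose hS.nonempty
  | k + 1 => Classical.choose (hS.exists_gt (g (seqW k)))

/-- Every selected level lies in `S`. [folklore] -/
theorem seqW_mem : ∀ k, seqW hS g k ∈ S
  | 0 => Classical.choose_spec hS.nonempty
  | k + 1 => (Classical.choose_spec (hS.exists_gt (g (seqW hS g k)))).1

/-- The next level is beyond the previous window. [folklore] -/
theorem lt_seqW_succ (k : ℕ) : g (seqW hS g k) < seqW hS g (k + 1) :=
  (Classical.choose_spec (hS.exists_gt (g (seqW hS g k)))).2

variable (hg : ∀ n, n ≤ g n)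
include hg

/-- The enumeration is strictly increasing (when `g n ≥ n`). [folklore] -/
theorem seqW_strictMono : StrictMono (seqW hS g) :=
  strictMono_nat_of_lt_succ fun k => (hg _).trans_lt (lt_seqW_succ hS g k)

/-- Windows of distinct selected levels are disjoint: if `L` lies in the windows `[n, g n]` of both
`seqW k` and `seqW k'` then `k = k'`. [folklore] -/
theorem seqW_window_unique {k k' L : ℕ} (hk : seqW hS g k ≤ L ∧ L ≤ g (seqW hS g k))
    (hk' : seqW hS g k' ≤ L ∧ L ≤ g (seqW hS g k')) : k = k' := by
  by_contra hne
  wlog hlt : k < k' generalizing k k'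
  · exact this hk' hk (Ne.symm hne) (by omega)
  have h1 : g (seqW hS g k) < seqW hS g (k + 1) := lt_seqW_succ hS g k
  have h2 : seqW hS g (k + 1) ≤ seqW hS g k' := (seqW_strictMono hS g hg).monotone hlt
  omega

end Sparse

/-! ### The window of a level and the advice budget -/

section Budget

variable {S : Set ℕ} (hS : S.Infinite) (B : ℕ → ℕ)

/-- The end of the window of input lengths of level `n`: `⟨1ⁿ, s⟩` with `|s| ≤ B n` has length in
`[2n + 2, 2n + 2 + B n]`. [folklore] -/
def wEnd (n : ℕ) : ℕ := 2 * n + 2 + B n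

/-- `n ≤ wEnd B n`. [folklore] -/
theorem le_wEnd (n : ℕ) : n ≤ wEnd B n := by unfold wEnd; omega

/-- `L` is in the window of level `n`. [folklore] -/
def InWin (n L : ℕ) : Prop := 2 * n + 2 ≤ L ∧ L ≤ wEnd B n

/-- **The level read off an input length** along the sparse sequence (`0` if none). [folklore] -/
noncomputable def nOfW (L : ℕ) : ℕ :=
  open scoped Classical in
  if h : ∃ k, InWin B (seqW hS (wEnd B) k) L then seqW hS (wEnd B) (Classical.choose h) else 0

/-- On the window of a selected level the level is read off correctly. [folklore] -/
theorem nOfW_window {k L : ℕ} (hL : InWin B (seqW hS (wEnd B) k) L) : nOfW hS B L = seqW hS (wEnd B) k := by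
  classical
  have h : ∃ k, InWin B (seqW hS (wEnd B) k) L := ⟨k, hL⟩
  rw [nOfW, dif_pos h]
  have hk := Classical.choose_spec h
  have heq : Classical.choose h = k :=
    seqW_window_unique hS (wEnd B) (le_wEnd B) ⟨by have := hk.1; omega, hk.2⟩ ⟨by have := hL.1; omega, hL.2⟩
  rw [heq]

/-- The level read off a length is at most the length. [folklore] -/
theorem nOfW_le (L : ℕ) : nOfW hS B L ≤ L := by
  classical
  unfold nOfW
  split_ifs with h
  · have := (Classical.choose_spec h).1; omega
  · exact Nat.zero_le _

/-- **The advice budget**: on the windows of the selected levels, `D`'s coin count on the post-processed input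
of that level; `0` elsewhere. [folklore] -/
noncomputable def clW (D : RandAlg (List Bool) Bool) (ℓ' : ℕ → ℕ) (L : ℕ) : ℕ :=
  open scoped Classical in
  if ∃ k, InWin B (seqW hS (wEnd B) k) L then D.coinLen (2 * nOfW hS B L + 2 + ℓ' (nOfW hS B L)) else 0

/-- On the window of a selected level the budget is `D`'s coin count for that level. [folklore] -/
theorem clW_window (D : RandAlg (List Bool) Bool) (ℓ' : ℕ → ℕ) {k L : ℕ} (hL : InWin B (seqW hS (wEnd B) k) L) :
    clW hS B D ℓ' L = D.coinLen (2 * seqW hS (wEnd B) k + 2 + ℓ' (seqW hS (wEnd B) k)) := by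
  classical
  rw [clW, if_pos ⟨k, hL⟩, nOfW_window hS B hL]

/-- The budget is polynomially bounded. [Arora–Barak 2009, Def. 7.1] [folklore] -/
theorem clW_le (D : RandAlg (List Bool) Bool) {ℓ' : ℕ → ℕ} {p P' : Polynomial ℕ} (hp : ∀ k, D.coinLen k ≤ p.eval k)
    (hP' : ∀ n, ℓ' n ≤ P'.eval n) (L : ℕ) : clW hS B D ℓ' L ≤ (p.comp (2 * X + 2 + P')).eval L := by
  classical
  unfold clW
  split_ifs with h
  · have hnL := nOfW_le hS B L
    calc D.coinLen (2 * nOfW hS B L + 2 + ℓ' (nOfW hS B L)) ≤ p.eval (2 * nOfW hS B L + 2 + ℓ' (nOfW hS B L)) := hp _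
      _ ≤ p.eval (2 * L + 2 + P'.eval L) := polynomial_eval_mono p (by
          have := (hP' (nOfW hS B L)).trans (polynomial_eval_mono P' hnL); omega)
      _ = (p.comp (2 * X + 2 + P')).eval L := by simp [Polynomial.eval_comp]
  · exact Nat.zero_le _

end Budget

end PostProcVar

open PostProcVar

/-- Non-negligible nonnegative sequences are frequently above an inverse polynomial (private copy).
[Goldreich 2001, Def. 1.3.5] [folklore] -/
private theorem exists_frequently_ge_of_not_negligible_vl {u : ℕ → ℝ} (h0 : ∀ n, 0 ≤ u n)
    (h : ¬ SuperpolynomialDecay atTop (fun n : ℕ => (n : ℝ)) u) :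
    ∃ c : ℕ, ∃ᶠ n : ℕ in atTop, 1 / (n : ℝ) ^ c ≤ u n := by
  have h' := (isNegligible_iff_eventually_lt_of_nonneg h0).not.1 h
  push Not at h'
  obtain ⟨c, hc⟩ := h'
  exact ⟨c, by simpa [Filter.not_eventually, not_lt] using hc⟩

/-- `|1ⁿ| = n`. [folklore] -/
private theorem length_unaryEncodeNat_vl (n : ℕ) : (unaryEncodeNat n).length = n := unary_decode_encode_nat n

/-- **Acceptance of the composed distinguisher on variable-length samples**: if every sample of `X` has length
`≤ B n`, `F` maps the game inputs of level `n` to length `ℓ'(n)`, and the budget equals `D`'s coin count at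
`2n + 2 + ℓ'(n)` on the whole window of `n`, then `lift D F cl` accepts `X` as `D` accepts `F(1ⁿ, X)`.
[cite: Goldreich2001, Def. 3.2.2] -/
theorem acceptPMF_lift_of_length_le (D : RandAlg (List Bool) Bool) (F : List Bool → List Bool) (cl : ℕ → ℕ) (n : ℕ)
    (X : PMF (List Bool)) {Bn ℓ' : ℕ} (hX : ∀ s ∈ X.support, s.length ≤ Bn)
    (hF : ∀ s ∈ X.support, (F (boolPair (unaryEncodeNat n) s)).length = ℓ')
    (hcl : ∀ L, 2 * n + 2 ≤ L → L ≤ 2 * n + 2 + Bn → cl L = D.coinLen (2 * n + 2 + ℓ')) :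
    acceptPMF (lift D F cl) n X = acceptPMF D n (X.map fun s => F (boolPair (unaryEncodeNat n) s)) := by
  rw [acceptPMF, acceptPMF, PMF.bind_map]
  refine pmf_bind_congr_of_mem_support X fun s hs => ?_
  have hlen : cl (boolPair (unaryEncodeNat n) s).length = D.coinLen (postFn F (boolPair (unaryEncodeNat n) s)).length := by
    rw [postFn_boolPair, length_boolPair, length_boolPair, length_unaryEncodeNat_vl, hF s hs]
    exact hcl _ (by omega) (by have := hX s hs; omega)
  rw [Function.comp_apply, outputPMF_lift D F cl _ hlen, postFn_boolPair]

/-- **Computational indistinguishability is preserved by polynomial-time post-processing of variable-length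
samples.** Let `X ≈ Y` be ensembles whose samples at level `n` have length AT MOST `B(n)` (`B` a polynomial),
and let `F ∈ FP` map every game input `⟨1ⁿ, s⟩` with `|s| ≤ B(n)` to a string of length `ℓ'(n)`. Then
`n ↦ F(1ⁿ, X_n)` and `n ↦ F(1ⁿ, Y_n)` are computationally indistinguishable.
[cite: Goldreich2001, §3.2.3 ("The Hybrid Technique: A Digest", PDF p. 141)] -/
theorem IsCompIndistinguishable.map_fp_of_length_le {X Y : Ensemble (List Bool)} {B : Polynomial ℕ} {ℓ' : ℕ → ℕ}
    (h : IsCompIndistinguishable X Y) (hX : ∀ n, ∀ s ∈ (X n).support, s.length ≤ B.eval n)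
    (hY : ∀ n, ∀ s ∈ (Y n).support, s.length ≤ B.eval n)
    {F : List Bool → List Bool} (hF : F ∈ FP)
    (hFlen : ∀ n (s : List Bool), s.length ≤ B.eval n → (F (boolPair (unaryEncodeNat n) s)).length = ℓ' n) :
    IsCompIndistinguishable (fun n => (X n).map fun s => F (boolPair (unaryEncodeNat n) s))
      (fun n => (Y n).map fun s => F (boolPair (unaryEncodeNat n) s)) := by
  intro D hD
  by_contra hneg
  set adv : ℕ → ℝ := distAdvantage D (fun n => (X n).map fun s => F (boolPair (unaryEncodeNat n) s))
    (fun n => (Y n).map fun s => F (boolPair (unaryEncodeNat n) s)) with hadv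
  obtain ⟨c, hc⟩ := exists_frequently_ge_of_not_negligible_vl (fun n => distAdvantage_nonneg D _ _ n) hneg
  set S : Set ℕ := {n | 1 / (n : ℝ) ^ c ≤ adv n} with hSdef
  have hSinf : S.Infinite := Nat.frequently_atTop_iff_infinite.1 hc
  -- `ℓ'` is polynomially bounded
  obtain ⟨P', hP'⟩ : ∃ P' : Polynomial ℕ, ∀ n, ℓ' n ≤ P'.eval n := by
    obtain ⟨pF, M, hM⟩ := hF
    refine ⟨(Polynomial.X + Polynomial.C (TM2Comp.machinePushBound M.tm) * pF).comp (2 * Polynomial.X + 2 + B), fun n => ?_⟩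
    have h1 := (hM (boolPair (unaryEncodeNat n) (List.replicate (B.eval n) false))).length_le
    simp only [id] at h1
    rw [hFlen n _ (by rw [List.length_replicate]), length_boolPair, length_unaryEncodeNat_vl, List.length_replicate] at h1
    calc ℓ' n ≤ (Polynomial.X + Polynomial.C (TM2Comp.machinePushBound M.tm) * pF).eval (2 * n + 2 + B.eval n) := by
          simpa using h1
      _ = _ := by simp [Polynomial.eval_comp]
  -- the composed distinguisher with the sparse advice budget is PPT
  obtain ⟨p, hp⟩ := hD.2
  set Bf : ℕ → ℕ := fun n => B.eval n with hBf
  have hPPT : IsPPT (lift D F (clW hSinf Bf D ℓ')) encodeBool :=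
    isPPT_lift hD hF ⟨_, clW_le hSinf Bf D hp hP'⟩
  have hdec := h (lift D F (clW hSinf Bf D ℓ')) hPPT
  -- on the selected levels the two advantages agree
  have hagree : ∀ k, distAdvantage (lift D F (clW hSinf Bf D ℓ')) X Y (seqW hSinf (wEnd Bf) k) = adv (seqW hSinf (wEnd Bf) k) := by
    intro k
    set n := seqW hSinf (wEnd Bf) k with hn
    have hcln : ∀ L, 2 * n + 2 ≤ L → L ≤ 2 * n + 2 + B.eval n → clW hSinf Bf D ℓ' L = D.coinLen (2 * n + 2 + ℓ' n) :=
      fun L h1 h2 => clW_window hSinf Bf D ℓ' ⟨h1, h2⟩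
    simp only [hadv, distAdvantage]
    rw [acceptPMF_lift_of_length_le D F _ n (X n) (hX n) (fun s hs => hFlen n s (hX n s hs)) hcln,
      acceptPMF_lift_of_length_le D F _ n (Y n) (hY n) (fun s hs => hFlen n s (hY n s hs)) hcln]
  -- contradiction: eventually below `1/mᶜ`, but at least `1/mᶜ` on every selected level
  have hev : ∀ᶠ m in atTop, distAdvantage (lift D F (clW hSinf Bf D ℓ')) X Y m < 1 / (m : ℝ) ^ c :=
    (isNegligible_iff_eventually_lt_of_nonneg fun m => distAdvantage_nonneg _ _ _ m).1 hdec c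
  have hmono : StrictMono (seqW hSinf (wEnd Bf)) := seqW_strictMono hSinf (wEnd Bf) (le_wEnd Bf)
  have htend : Tendsto (seqW hSinf (wEnd Bf)) atTop atTop := hmono.tendsto_atTop
  obtain ⟨k, hk⟩ := (htend.eventually hev).exists
  have h1 : 1 / ((seqW hSinf (wEnd Bf) k : ℕ) : ℝ) ^ c ≤ adv (seqW hSinf (wEnd Bf) k) := seqW_mem hSinf (wEnd Bf) k
  rw [← hagree k] at h1
  exact absurd hk (not_lt.2 h1)

end Literature.Computability.Cryptography
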